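import Literature.NumberTheory.EllipticCurves.Kato2004.AdditivePotGoodRankZeroShaUpperBoundFineSelmerAtTwo
import HarnessLib

/-!
# Kato 2004 at `p = 2`, SHARP form: the rank-`0` upper bound at an ADDITIVE, POTENTIALLY GOOD `2` for IRREDUCIBLE `E[2]`, granted Coates–Sujatha's statement (A) at `(E, 2)` — `ord₂ #Ш(E/ℚ)[2^∞] + v₂(Tam E) ≤ ord₂(L(E,1)/Ω_E)`, WITHOUT the `+ 1` of the two earlier readings (ONE named fact; a READING of Kato's proofs at `p = 2`)

Topic `NumberTheory/EllipticCurves`, sub-directory `Kato2004` (namespace = path). ONE named fact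
(`def … : Prop`, D-0014), nothing else (that it implies the two earlier readings is pure logic,
recorded on the Summits side by its first consumer). It SHARPENS the two facts of `Kato2004/AdditivePotGoodRankZeroShaUpperBoundFineSelmerAtTwo.lean`
(`…_le_add_one_at_two_of_negDisc_of_irreducible_of_fineSelmerDual_fg`, steps T1–T10, and its
`Δ`-free APPEND `…_le_add_one_at_two_of_irreducible_of_fineSelmerDual_fg`, steps T1′–T7′; the
statements of Kato's 12.2, 12.4–12.6, 13.8, 13.13–13.14, 14.13–14.16 and the derivations are in
those module docstrings and are not repeated) by REMOVING the displayed `+ 1`. That `+ 1` is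
located precisely in the earlier readings (T9 and the CONSISTENCY CHECK of the APPEND): Kato's
zeta element for `γ = γ⁺` has `exp*_ω(z) = 2·L(E,1)/Ω_E·u` because `Ω⁺_γ = Ω_E/2`, and the bound
(★)/(★★) `#H²(ℤ[1/2],T) ≤ 2^{μ(𝐇'²) − m}·[H¹(ℤ[1/2],T) : z]` was used with the trivial
estimate `m ≥ 0` for the `2`-adic content `m` of `z' = φ·b` in the free rank-one `Λ'`-module
`𝐇'¹(T) = Λ'·b` («the displayed `+ 1` is the unproved divisibility `2 ∣ z'` in `𝐇'¹(T)`
(`m = 1`)»). This file records the proof of that divisibility — `z' ∈ 2·𝐇'¹(T)`, i.e. `m ≥ 1` —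
from Kato's printed statements plus four elementary steps T11–T14, written out below for the
referee. Written by the prover seat `bsd-2adic-addL2x` GEN 8 (cell `bsd-2adic`, rung K4, crux
stmt-BirchSwinnertonDyer-19098 `AdditiveRankZeroAtTwo`, stub `stub_addDefectUpper` = hU3 on the
defect-`≥ 3` sub-class), continuing GEN 5's reading; repair-census entry R-B43. Flag for the
referee (reading audit wanted, lit-kato format):
`Kato-12.4(2)-12.5(1)(3)-12.6-13.8-13.14-14.14-at-two-anyDisc-irreducible-fineSelmer-fg-sharp`.

## Notation (as in the two earlier readings)

`E/ℚ` non-CM, globally minimal `W`, ADDITIVE and POTENTIALLY GOOD at `2`, `E[2]` IRREDUCIBLE,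
`L(E,1) ≠ 0`, `Ш(E/ℚ)` finite; `T = T₂E`, `V = T ⊗ ℚ`; `c` = complex conjugation.
`G_∞ = Gal(ℚ(ζ_{2^∞})/ℚ) = Δ × U`, `Δ = ⟨σ_{−1}⟩` (and `σ_{−1}` restricts to `c` on every
`ℚ(ζ_{2^n})`), `U = Gal(ℚ(ζ_{2^∞})/ℚ(i)) ≅ 1 + 4ℤ₂ ≅ ℤ₂`; `Λ = ℤ₂[[G_∞]]` (Kato's ring; not
regular), `Λ_U := ℤ₂[[U]] ≅ ℤ₂[[Y]]` (a REGULAR local ring of dimension `2`, maximal ideal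
`(2, Y)`, `Y = u − 1`; `Λ = Λ_U ⊕ Λ_U·σ_{−1}` is a free `Λ_U`-module of rank `2`),
`Λ' = ℤ₂[[Gal(ℚ^cyc/ℚ)]] ≅ ℤ₂[[X]]`; `𝐇^q(T) = lim_n H^q(ℤ[ζ_{2^n},1/2], T)` (Kato 12.2, a
`Λ`-module; for `n ≥ 2` this is the Iwasawa cohomology of `T` along the cyclotomic
`ℤ₂`-extension `ℚ(ζ_{2^∞})/ℚ(i)`, a `Λ_U`-module), `𝐇'^q(T) = lim_m H^q(ℤ_m[1/2], T)` over
the layers `ℚ_m = ℚ(ζ_{2^{m+2}})⁺` of `ℚ^cyc` (`res`, `cores` between `ℚ_m ⊂ ℚ(ζ_{2^{m+2}})`,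
degree `2`: `cores∘res = 2`, `res∘cores = 1 + c`). Kato's `z_γ = z_γ^{(2)} ∈ 𝐇¹(V_{F_λ}(f))`
(§13.9) for `γ ∈ V_F(f)`, `f = f_E`, `F = ℚ`; `V(f)(1) ≅ V₂E` (Kato 14.10), and
`z̃_γ ∈ 𝐇¹(V₂E)` denotes the image of `z_γ` under Kato's twist isomorphism
`𝐇¹(V(f)) ≅ 𝐇¹(V(f)(1))`, «the product with `(ζ_{2^n})_n^{⊗(k−r)}`», `k − r = 2 − 1 = 1`
(Thm. 12.5 (1)); `γ⁺` = a `ℤ₂`-basis of `H¹(E(ℂ),ℤ₂)^{c = 1} = T(−1)⁺` as in T9;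
`z̃ := z̃_{γ⁺}`, with level-`n` components `z̃_n ∈ H¹(ℤ[ζ_{2^n},1/2], V)`;
`z' := (cores_{ℚ(ζ_{2^{m+2}}) → ℚ_m} z̃_{m+2})_m ∈ 𝐇'¹(T) ⊗ ℚ` (the earlier readings' `z'`,
shown there to lie in `𝐇'¹(T)`, T5), bottom class `z = z'_0 = cores_{ℚ(i)/ℚ} z̃_2 ∈ H¹(ℤ[1/2], V)`.

## The four steps (T11–T14) and the sharpened count

* **T11 (Thm. 12.4 (3) for the regular ring `Λ_U` at `p = 2` — Kato's proof 13.8 verbatim over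
  `ℚ(i)`).** `𝐇¹(T)` is a finitely generated `Λ`-module, hence a finitely generated `Λ_U`-module
  ((12.2.1), printed for every `p`: «`𝐇¹(T)` and `𝐇²(T)` are finitely generated
  `ℤ_p[[G_∞]]`-modules»), and it is `Λ`-torsion-free (Thm. 12.4 (2), printed for EVERY `p`:
  «for any non-zero-divisor `x` of `Λ`, `x : 𝐇¹(T) → 𝐇¹(T)` is injective», 13.8), hence
  `Λ_U`-torsion-free (a non-zero element of the domain `Λ_U` is a non-zero-divisor of the free
  `Λ_U`-module `Λ`). CLAIM: `𝐇¹(T)` is a FREE `Λ_U`-module (of rank `2 = rank_{ℤ₂} T·r₂(ℚ(i))`,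
  not needed). Proof = 13.8's regular-sequence argument for the maximal ideal `(x, y) = (2, Y)`
  of `Λ_U`: `x = 2` is injective (torsion-freeness); from `0 → T ⊗ Λ →·2 T ⊗ Λ → T ⊗ Λ/2Λ → 0`
  (Kato's identification `𝐇^q(T) = lim_n H^q(ℤ[1/2], T ⊗ ℤ₂[G_n]) =: H^q(ℤ[1/2], T ⊗ Λ)`,
  13.8) one has `𝐇¹(T)/2𝐇¹(T) ↪ H¹(ℤ[1/2], T ⊗ Λ/2Λ)`, and from
  `0 → T ⊗ Λ/2Λ →·Y T ⊗ Λ/2Λ → T ⊗ Λ/(2, Y)Λ → 0` (`Y` is a non-zero-divisor of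
  `Λ/2Λ = 𝔽₂[[U]][Δ]`, free over `𝔽₂[[Y]]`) the `Y`-torsion of `H¹(ℤ[1/2], T ⊗ Λ/2Λ)` is the
  image of `H⁰(ℤ[1/2], T ⊗ Λ/(2,Y)Λ)`; here `Λ/(2,Y)Λ = 𝔽₂[G_∞/U] = 𝔽₂[Gal(ℚ(i)/ℚ)]`, so
  `T ⊗ Λ/(2,Y)Λ = Ind_{ℚ(i)}^{ℚ} E[2]` and `H⁰(ℚ, Ind_{ℚ(i)}^{ℚ} E[2]) = H⁰(ℚ(i), E[2]) = 0` —
  the `2`-division field `ℚ(E[2])` has degree `3` or `6` (irreducible cubic), so `E[2]` has no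
  non-zero point over the quadratic field `ℚ(i)` (nor over any `ℚ(ζ_{2^n})`, a `2`-power
  extension). Hence `(2, Y)` is an `𝐇¹(T)`-regular sequence, `depth_{Λ_U} 𝐇¹(T) = 2 = dim Λ_U`,
  and a finitely generated module of depth `2` over a `2`-dimensional regular local ring is free
  (Auslander–Buchsbaum). [This is exactly why Kato needs `p ≠ 2` in 12.4 (3): freeness over the
  non-regular `Λ` is not available at `2`; freeness over `Λ_U` is, by his own proof.]
* **T12 (Thm. 12.5 (4), first clause, for `Λ_U` — Kato's 13.14 verbatim).** Thm. 12.6 (printed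
  for every `p`; `T = V_{ℤ₂}(f)`): the `Λ`-span `Z ⊂ 𝐇¹(T)` of the integral elements (1)(2) of
  §8 satisfies `Z ⊂ Z(f,T)` and `Z(f,T)/Z` is FINITE, where `Z(f,T)` is the `Λ`-submodule of
  `𝐇¹(T) ⊗ Q(Λ)` generated by the `z_γ`, `γ ∈ T`. 13.14 then reads, with `Λ_U` for `Λ`: a finite
  `Λ_U`-module vanishes after localisation at every height-one prime `𝔮` of `Λ_U`, so
  `Z(f,T)_𝔮 = Z_𝔮 ⊂ 𝐇¹(T)_𝔮` for every such `𝔮`; a free (hence reflexive) module over the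
  normal domain `Λ_U` satisfies `𝐇¹(T) = ⋂_𝔮 𝐇¹(T)_𝔮` inside `𝐇¹(T) ⊗ Q(Λ_U)`; hence
  `Z(f,T) ⊂ 𝐇¹(T)`, i.e. `z_γ ∈ 𝐇¹(T)` for every `γ ∈ T`. [Equivalently: `𝐇¹(T) ≅ Λ_U^2`,
  and `(Q(Λ_U)/Λ_U)^2 ⊃ (Λ_U z_γ + 𝐇¹(T))/𝐇¹(T)` has no non-zero finite `Λ_U`-submodule, since
  `Y^j·a ∈ 2^k ℤ₂[[Y]] ⇒ a ∈ 2^k ℤ₂[[Y]]` in the UFD `ℤ₂[[Y]]`.] The statement «`z_γ ∈ 𝐇¹(T)` for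
  all `γ` in the lattice» is invariant under homothety of the lattice, and with `E[2]` irreducible
  every `G_ℚ`-stable lattice of `V(f)` is `2^k·V_{ℤ₂}(f)` (Remark 12.8's argument), in particular
  `H¹_ét(E_{ℚ̄}, ℤ₂) = T₂E(−1) ∋ γ⁺`; under the integral twist isomorphism
  `𝐇¹(T(f)) ⊗ ℤ₂(1) ≅ 𝐇¹(T(f)(1))` this gives: `z̃ = z̃_{γ⁺} ∈ 𝐇¹(T₂E)`, i.e. EVERY LEVEL
  COMPONENT `z̃_n ∈ H¹(ℤ[ζ_{2^n}, 1/2], T₂E)` (`n ≥ 2`) IS INTEGRAL. (The earlier readings proved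
  only the integrality of the `ℚ^cyc`-tower shadow `z'`, T5.)
* **T13 (complex conjugation — Thm. 12.5 (1), last clause, p. 221, and §13.9, p. 230, verbatim,
  plus the Tate-twist sign).** Kato prints: «We have `z^{(p)}_{ι(γ)} = −σ_{−1}(z^{(p)}_γ)` where
  `ι : V_{F_λ}(f) → V_{F_λ}(f)` is the action of the complex conjugation» (Thm. 12.5 (1)),
  proved in 13.9: «This also shows `z^{(p)}_{ι(γ)} = −σ_{−1}(z^{(p)}_γ)` since the action of
  `σ_{−1}` on `𝐇¹(V_{F_λ})` commutes with the action of `−χ(−1)` on `S(f) ⊗_F F_λ` via the map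
  (13.7.1)» (and `𝐇¹(V_{F_λ}(f))` is free of rank `1` over `Λ ⊗ ℚ`, Thm. 12.4 (2)). The twist
  isomorphism `𝐇¹(T) ⊗ ℤ₂(1) ≅ 𝐇¹(T(1))` (cup product with `(ζ_{2^n})_n`, levelwise
  `H¹(ℤ[ζ_{2^n},1/2], T/2^n) ⊗ μ_{2^n} ≅ H¹(ℤ[ζ_{2^n},1/2], T/2^n(1))`) is `Λ`-SEMILINEAR for the
  automorphism `σ ↦ χ_cyc(σ)σ` of `Λ` (`σ(x ∪ ζ) = σx ∪ σζ = χ_cyc(σ)·(σx ∪ ζ)`), so `σ_{−1}`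
  acts on the twisted element with the extra sign `χ_cyc(σ_{−1})^{k−r} = (−1)^1`:
  `σ_{−1}(z̃_γ) = −(σ_{−1} z_γ)^~ = (z_{ι(γ)})^~ = z̃_{ι(γ)}` in `𝐇¹(V₂E)`. For `γ = γ⁺`
  (`ι γ⁺ = γ⁺`): `σ_{−1} z̃ = z̃`, i.e. for every `n ≥ 2` the level component
  `z̃_n ∈ H¹(ℤ[ζ_{2^n},1/2], V)` is FIXED by the complex conjugation
  `c ∈ Gal(ℚ(ζ_{2^n})/ℚ(ζ_{2^n})⁺)` acting on `H¹` by transport of structure (the `Λ`-module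
  structure of `𝐇¹` is this action levelwise, 13.8; for the involution `σ_{−1}` no
  left/right/inverse convention intervenes). [Consistency, not used: were `z̃` ANTI-invariant,
  `res∘cores z̃_{m+2} = (1 + c) z̃_{m+2} = 0` would force `z' = 0` (`res` is injective, T14),
  contradicting `exp*_ω(z) = 2L(E,1)/Ω_E ≠ 0` (T9); and Thm. 12.5 (1) itself gives, for an ODD
  character `χ` of `G_n`, `Σ_σ χ(σ) σ exp*(z̃_{γ⁺,n}) = L(E,χ,1)·(γ⁺)^{−} = 0`: the odd-character
  parts of `exp* z̃_{γ⁺,n}` vanish, as they must for a `c`-invariant class. The `χ`-parts for odd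
  `χ` of the full Euler system come from `γ⁻`.]
* **T14 (descent of `c`-invariant classes along `ℚ(ζ_{2^{m+2}})/ℚ_m`; elementary).** Let
  `G = Gal(ℚ_S/ℚ_m) ⊃ H = Gal(ℚ_S/ℚ(ζ_{2^{m+2}}))` (`S = {2, ∞} ∪ {ℓ ∣ N}`; `H ⊲ G` of index
  `2`, `G/H = ⟨c⟩`). Since `T^H = 0` (`E(ℚ(ζ_{2^{m+2}}))[2^∞]` is finite — indeed `E[2]` has no
  point over the `2`-power extension `ℚ(ζ_{2^{m+2}})` —, so `lim_k E(·)[2^k] = 0` under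
  multiplication by `2`), inflation–restriction `0 → H¹(G/H, T^H) → H¹(G,T) → H¹(H,T)^{G/H} →
  H²(G/H, T^H)` gives `res : H¹(G, T) ≅ H¹(H, T)^{c = 1}`; the same holds for the subgroups of
  classes unramified at the places above `ℓ ∣ N`, `ℓ ≠ 2` (Kato's `H¹(O[1/2], T) =
  H¹_ét(Spec O[1/2], j_*T)`, 8.2), because `ℚ(ζ_{2^{m+2}})/ℚ_m` is unramified at such `ℓ`
  (`I_w = I_v`). Both `H¹(ℤ_m[1/2],T)` and `H¹(ℤ[ζ_{2^{m+2}},1/2],T)` are `2`-torsion-free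
  (`H⁰(·, E[2^∞]) = 0`), so they embed in the `V`-cohomology and `c`-invariance may be read in
  either. Hence, by T12–T13: for every `m ≥ 0` there is a UNIQUE
  `y_m ∈ H¹(ℤ_m[1/2], T)` with `res(y_m) = z̃_{m+2}`, and `z'_m = cores(z̃_{m+2}) =
  cores∘res(y_m) = 2·y_m`. The `y_m` are norm-compatible: `ℚ_{m+1}` and `ℚ(ζ_{2^{m+2}})` are
  distinct quadratic extensions of `ℚ_m` inside `ℚ(ζ_{2^{m+3}}) = ℚ_{m+1}(ζ_{2^{m+2}})`, so
  (Mackey, one double coset) `res_m ∘ cores_{ℚ_{m+1}/ℚ_m} = cores_{ℚ(ζ_{2^{m+3}})/ℚ(ζ_{2^{m+2}})}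
  ∘ res_{m+1}`, whence `res_m(cores y_{m+1}) = cores(z̃_{m+3}) = z̃_{m+2} = res_m(y_m)` (Kato's
  elements are `cores`-compatible in the `ℚ(ζ_{2^n})`-tower — they form an element of the
  inverse limit `𝐇¹`) and `cores y_{m+1} = y_m` by injectivity of `res_m`. So
  `y' := (y_m)_m ∈ 𝐇'¹(T)` and **`z' = 2·y'` in `𝐇'¹(T)`**. In the notation of T5/T6
  (`𝐇'¹(T) = Λ'·b`, `z' = φ·b`, `m` = the `2`-adic content of `φ`): `φ ∈ 2Λ'`, **`m ≥ 1`**.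
* **The sharpened count.** Everything else is UNCHANGED (T1–T10 for `Δ_E < 0`; T1′–T7′, T8–T10
  for either sign): T3's `λ`-part comparison at height-one `𝔮 ∌ 2` is insensitive to the factor
  `2` (a unit in `Λ'_𝔮`); T6 (★) reads `#H²(ℤ[1/2],T) ≤ 2^{μ₂ − m}·[H¹(ℤ[1/2],T) : z] ≤
  2^{−1}·[H¹(ℤ[1/2],T) : z]` (`μ₂ = 0` under (A), `Δ_E < 0`), and T6′/T7′ (★★) reads
  `#S₁(W) ≤ 2^{a + e − t − m} ≤ 2^{e − v₂(c₂) − 1} = 2^{ord₂(L(E,1)/Ω_E) − v₂(c₂)}` (T8: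
  `a = t − v₂(c₂)`; T9: `e = ord₂ exp*_ω(z) = 1 + ord₂(L(E,1)/Ω_E)`; T14: `m ≥ 1`). With T10
  (`S₁(W) ⊇ Ш(E/ℚ)[2^∞]` of index `∏_{ℓ odd} |c_ℓ|₂⁻¹`): TOTAL
  `ord₂ #Ш(E/ℚ)[2^∞] + Σ_ℓ v₂(c_ℓ) ≤ ord₂(L(E,1)/Ω_E)` for either sign of `Δ_E` — the statement
  typed below. [Equivalently: run T1–T10 / T1′–T7′ with `y'`, `y = y'_0` (`z = 2y`,
  `exp*_ω(y) = L(E,1)/Ω_E·u`) in place of `z'`, `z`.]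

CONSISTENCY CHECK (not used). With `E(ℚ)[2] = 0` the Birch–Swinnerton-Dyer formula predicts
`ord₂ #Ш + Σ_ℓ v₂(c_ℓ) = ord₂(L(E,1)/Ω_E)` EXACTLY (`Ω_E = ∫_{E(ℝ)}|ω|`, the tree's
`realPeriodRat`, both signs of `Δ_E`): the sharp reading is the full «Euler-system half» of BSD₂ on
this class, with no spare factor; the earlier `+ 1` was the normalisation of `γ` in cohomology
(`[H₁(E(ℂ),ℤ) : H₁⁺ ⊕ H₁⁻] = 2` iff `Δ_E < 0`, `Ω⁺_{γ} = Ω_E/2` in both cases), now absorbed by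
`z' = 2y'`.

WHAT IS NOT CLAIMED. Statement (A) is NOT asserted (hypothesis); nothing for reducible `E[2]`
(T11, T12, T14 and the earlier T2, T5 use `H⁰(·, E[2]) = 0` over `ℚ(i)`, `ℚ(ζ_{2^n})`, `ℚ_m`), at a
potentially multiplicative `2` ((12.5.1)), in analytic rank `1`, or for CM curves (Kato §15 is not
read at `2`); no lower bound. The non-verbatim steps are T11 (13.8's argument with `(ℚ(i), Λ_U)`
for `(ℚ, Λ)`), T12 (13.14's argument with `Λ_U` for `Λ`), the sign bookkeeping in T13, T14, and
those listed in the two earlier readings; the verbatim inputs are Kato's (12.2.1), Thm. 12.4 (2),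
Thm. 12.5 (1) including «`z_{ι(γ)} = −σ_{−1}(z_γ)`», Thm. 12.5 (3) via Kato 1999 Thm. 0.8,
Thm. 12.6, 13.8, 13.9, 13.13–13.14, 14.13–14.16. Never stronger than what these arguments give;
no `_holds` (size XL). Derivation memo: `run/shared/lean/pub/bsd-2adic/addL2x/VERDICT-19098-addL2x-GEN8.md`.

THE LEAN STATEMENT. Exactly the `Δ`-free APPEND fact of the sibling file with the conclusion
`… ≤ padicValRat 2 q` instead of `… ≤ padicValRat 2 q + 1`.

## References

* K. Kato, Astérisque 295 (2004): (12.2.1) (p. 220), Thm. 12.4 (2)(3) (p. 221), Thm. 12.5 (1)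
  with its last clause «`z_{ι(γ)} = −σ_{−1}(z_γ)`» and the twist «product with
  `(ζ_{p^n})^{⊗(k−r)}`» (p. 221), Thm. 12.5 (3)(4), (12.5.1), (12.5.2) (p. 222), Thm. 12.6
  (p. 222), Remark 12.8 (p. 223), 13.8 (pp. 227–229), 13.9 (pp. 229–230), 13.12–13.14
  (pp. 231–234), 14.10, 14.13–14.16 (pp. 241–245). [Kato2004Asterisque]
* K. Kato, Kodai Math. J. 22 (1999) 313–372, Thm. 0.8. [Kato1999Kodai]
* W. Bruns, J. Herzog, *Cohen–Macaulay rings* (rev. ed. 1998), Thm. 1.3.3 (Auslander–Buchsbaum), Prop. 1.4.1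
  (reflexive modules over normal domains). [BrunsHerzog1998]
* J. Neukirch, A. Schmidt, K. Wingberg, *Cohomology of Number Fields* (2nd ed.), (1.6.7)
  inflation–restriction, (1.5.6)–(1.5.7) `cor∘res`, double cosets. [NeukirchSchmidtWingberg2008]
* K. Rubin, *Euler Systems*, Ann. of Math. Stud. 147 (2000), Ch. III §5 (Kato's Euler system for
  `T_pE`, both parities of characters). [Rubin2000]
* J. Coates, R. Sujatha, Math. Ann. 331 (2005) 809–839, statement (A). [CoatesSujatha2005]
-/

noncomputable section

open scoped Classical

namespace Literature.NumberTheory.EllipticCurves.Kato2004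

open WeierstrassCurve

/-- **Kato's Euler-system bound at an additive, potentially good prime `2`, in analytic rank `0`,
for IRREDUCIBLE `E[2]` and either sign of the discriminant, GRANTED Coates–Sujatha's statement (A)
at `(E, 2)` — SHARP form: `ord₂ #Ш(E/ℚ)[2^∞] + v₂(∏_ℓ c_ℓ) ≤ ord₂(L(E,1)/Ω_E)`.** The two earlier
readings of the sibling file (flags `…-plus-one`) with their `+ 1` removed: the `+ 1` was the
trivial estimate `m ≥ 0` for the `2`-adic content of Kato's element in the free `Λ'`-module
`𝐇'¹(T)`, and `m ≥ 1` holds because the `ℚ^cyc`-tower element is TWICE an integral element: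
Kato's **Thm. 12.5 (1)** prints `z_{ι(γ)} = −σ_{−1}(z_γ)` (§13.9), so after the Tate twist by
`(ζ_{2^n})^{⊗1}` to `T₂E`-coefficients the element for `γ = γ⁺` is FIXED by complex conjugation at
every level `ℚ(ζ_{2^{m+2}})` (T13); it is INTEGRAL at every level because `𝐇¹(T)` is free over the
REGULAR ring `Λ_U = ℤ₂[[Gal(ℚ(ζ_{2^∞})/ℚ(i))]]` by Kato's proof **13.8** of Thm. 12.4 (3) run over
`ℚ(i)` (`H⁰(ℚ(i), E[2]) = 0`; **(12.2.1)**, **Thm. 12.4 (2)** printed for every `p`) and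
**Thm. 12.6** + **13.14** (T11–T12); and a `c`-fixed integral class over `ℚ(ζ_{2^{m+2}})` is the
restriction of a unique integral class over `ℚ_m = ℚ(ζ_{2^{m+2}})⁺` (inflation–restriction,
`T^{G_{ℚ(ζ)}} = 0`), norm-compatibly in `m`, so `z' = cores∘res(y') = 2y'` in `𝐇'¹(T)` (T14).
The rest is the earlier readings' T1–T10 / T1′–T7′ word for word (**Thm. 12.5 (3)** at `2` via
Kato 1999 Thm. 0.8, **14.14 + Lemma 14.15**, **Prop. 14.16** or the Poitou–Tate count with the
real place inserted, the local index at the additive `2`, the period `Ω⁺_γ = Ω_E/2`). See the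
module docstring (T11–T14, «the sharpened count», what is not claimed). Let `W/ℚ` be a globally
minimal NON-CM elliptic curve with ADDITIVE and POTENTIALLY GOOD reduction at `2`
(`0 ≤ ord₂ j(W)`), `E[2]` irreducible, `L(E,1) ≠ 0`, `Ш(E/ℚ)` finite, and assume (`hA`) that for
every cyclotomic `ℤ₂`-extension datum `κ` of `ℚ` some Pontryagin-dual datum `D` of
`Sel₀(ℚ^cyc, E[2^∞])` has `ℤ₂`-finitely generated underlying module. Then there is `q ∈ ℚ` with
`L(E,1)/Ω(W) = q` and `ord₂ #Ш(E/ℚ)(2) + v₂(Tam(W)) ≤ ord₂ q`. A READING (non-verbatim steps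
written out in the module docstrings of this file and its sibling); never stronger than what the
arguments give; no `_holds` (size XL). Flag for the referee:
`Kato-12.4(2)-12.5(1)(3)-12.6-13.8-13.14-14.14-at-two-anyDisc-irreducible-fineSelmer-fg-sharp`.
[cite: Kato2004Asterisque, (12.2.1) (p. 220), Thm. 12.4 (2)(3) (p. 221), Thm. 12.5 (1) incl. its last clause (p. 221), Thm. 12.5 (3)(4) and (12.5.1) (p. 222), Thm. 12.6 (p. 222), Remark 12.8 (p. 223), 13.8 (pp. 227–229), 13.9 (pp. 229–230), 13.13–13.14 (pp. 233–234), 14.13–14.14 and Lemma 14.15 (pp. 242–244), Prop. 14.16 (2) (pp. 244–245)]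
[cite: Kato1999Kodai, Thm. 0.8 (p. 318)]
[cite: BrunsHerzog1998, Thm. 1.3.3, Prop. 1.4.1]
[cite: NeukirchSchmidtWingberg2008, (1.6.7), (1.5.6)–(1.5.7)]
[cite: Rubin2000, Ch. I §3 and Thm. I.7.3; Ch. III §5]
[cite: Lim2017FineSelmer, §3] [cite: CoatesSujatha2005, statement (A) (introduction and §3)]
[cite: BlochKato1990, §3 Def. 3.10, Ex. 3.11, Prop. 3.8]
[cite: SilvermanAEC2009, IV.6.4, Thm. X.4.14] [cite: Tate1975, §1]
[cite: GreenbergLNM1716, Prop. 4.13] -/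
def rankZero_padicValNat_sha_add_padicValNat_tamagawa_le_at_two_of_irreducible_of_fineSelmerDual_fg :
    Prop :=
  ∀ (W : WeierstrassCurve ℚ) [W.IsElliptic] [W.IsGloballyMinimal], ¬ W.HasCM →
    ¬ W.HasGoodReductionAtPrime 2 → ¬ W.HasMultiplicativeReductionAtPrime 2 →
    0 ≤ padicValRat 2 W.j →
    W.HasIrreducibleModPGaloisRep 2 →
    (∀ (κ : ZpExtension ℚ 2), κ.IsCyclotomic →
      ∃ (γ : Field.absoluteGaloisGroup ℚ) (D : W.FineSelmerDualData κ γ),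
        Module.Finite ℤ_[2] (RestrictScalars ℤ_[2] (IwasawaAlgebra 2) D.X)) →
    W.entireLFunction 1 ≠ 0 → Finite W.sha →
    ∃ q : ℚ, W.entireLFunction 1 / (W.realPeriodRat : ℂ) = (q : ℂ) ∧
      (padicValNat 2 (Nat.card (AddCommGroup.primaryComponent W.sha 2)) : ℤ) +
          padicValNat 2 W.tamagawaProduct ≤ padicValRat 2 q

end Literature.NumberTheory.EllipticCurves.Kato2004

end
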